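import Mathlib
import Summits.ValiantsHypothesis.ValiantsHypothesis.Theorems.LacunarySymmetroidMatrixDescartesLowRankSector

/-!
# `MatrixDescartes` (stmt-ValiantsHypothesis-18050) — FEW FAT LETTERS: inside the size window, a pencil
# violating the crux's inequality needs `≳ K/polylog K` coefficients of rank `≥ K^{Ω(1/q)}`

HONEST FRAMING.  Cell `pub-symmetroid`, seat `val-sym-mdr-p2`; helper file `--supports` the crux
`Theses.LacunarySymmetroid.MatrixDescartes`.  A NECESSARY CONDITION on would-be counterexamples, obtained
from the size-free low-rank ceiling (tree `lowRankCeiling`) and the crux's own size bound; it decides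
nothing about the crux, nothing about `DoorA26` / `DoorA34`, nothing about `VP ≠ VNP`.

STATEMENT (`fewFatLetters_mdr`).  For all `c, q, s` there is `K₀` such that for every `K ≥ K₀`, every size
`m ≤ 2^((⌊log₂K⌋+c)^c)` (the crux's regime), all exponents and all real `m × m` coefficients `Sₗ` (no
symmetry needed): if the set `F` of "fat" letters — those of rank `≥ 2^s` — satisfies
`4·q·|F|·((⌊log₂K⌋+c)^c + 1) ≤ K⌊log₂K⌋`, then `Z^q ≤ 2^(K⌊log₂K⌋)` for the number `Z` of distinct
real zeros of `det (∑ₗ X^{dₗ} Sₗ)`.  (`K₀` absorbs `4qs ≤ ⌊log₂K⌋`, i.e. thin letters have rank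
`< 2^s ≤ K^{1/(4q)}`.)  Contrapositive: a family of pencils refuting `MatrixDescartes` at `(c, q)` must,
for all large `K`, carry MORE than `K⌊log₂K⌋ / (4q((⌊log₂K⌋+c)^c+1))` coefficients of rank `≥ K^{1/(4q)}`
— the interpolation between the low-rank sector (`|F| = 1`, size-free, tree `lowRankSector_mdr`) and the
Descartes-trivial small-size corner (`|F| = K`).

PROOF.  `lowRankCeiling` (pivot inside `F` or anywhere): `Z₊ + 1 ≤ ∏_{l ≠ l₀} (rank Sₗ + 1)`; fat factors are
`≤ m + 1 ≤ 2^((⌊log₂K⌋+c)^c+1)` (`Matrix.rank_le_width`), thin ones `≤ 2^s`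
(`FewFatLetters.prod_rank_succ_le`); the reflected pencil `Sₗ ↦ (−1)^{dₗ}Sₗ` has the same fat set
(tree `Literature.Computability.AlgebraicComplexity.rank_smul_le`), and `Z ≤ Z₊(F) + Z₊(F(−X)) + 1` (tree
`stub_negRoots`); the exponent arithmetic is `q(1 + |F|·L + sK) ≤ K⌊log₂K⌋` from the three quarters
`4q ≤ K⌊log₂K⌋`, `4q|F|L ≤ K⌊log₂K⌋`, `4qsK ≤ K⌊log₂K⌋`.  Elementary; axioms `propext`, `Classical.choice`,
`Quot.sound`.
-/

-- layout Summits/ValiantsHypothesis/ValiantsHypothesis forces the duplicated namespace component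
set_option linter.dupNamespace false

namespace Summit.ValiantsHypothesis.ValiantsHypothesis.Theorems.LacunarySymmetroidMatrixDescartes

open Polynomial Finset
open scoped BigOperators Polynomial

namespace FewFatLetters

/-- Factor bound: with `F ⊇ {l : rank Sₗ ≥ 2^s}`, `∏_{l ≠ l₀} (rank Sₗ + 1) ≤ (m+1)^{|F|} · (2^s)^{K−1}`
(fat factors `≤ m + 1` by `rank ≤ m`, thin factors `≤ 2^s`). [folklore] -/
theorem prod_rank_succ_le {K m : ℕ} (l₀ : Fin K) (S : Fin K → Matrix (Fin m) (Fin m) ℝ)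
    (F : Finset (Fin K)) (s : ℕ) (hthin : ∀ l, l ∉ F → (S l).rank < 2 ^ s) :
    ∏ l ∈ Finset.univ.erase l₀, ((S l).rank + 1) ≤ (m + 1) ^ F.card * (2 ^ s) ^ (K - 1) := by
  have hfac : ∀ l ∈ Finset.univ.erase l₀,
      (S l).rank + 1 ≤ (if l ∈ F then m + 1 else 1) * 2 ^ s := by
    intro l _
    by_cases hl : l ∈ F
    · rw [if_pos hl]
      have h1 : (S l).rank + 1 ≤ m + 1 := Nat.add_le_add_right (Matrix.rank_le_width (S l)) 1
      calc (S l).rank + 1 ≤ (m + 1) * 1 := by rw [mul_one]; exact h1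
        _ ≤ (m + 1) * 2 ^ s := Nat.mul_le_mul_left _ Nat.one_le_two_pow
    · rw [if_neg hl, one_mul]
      exact hthin l hl
  calc ∏ l ∈ Finset.univ.erase l₀, ((S l).rank + 1)
      ≤ ∏ l ∈ Finset.univ.erase l₀, ((if l ∈ F then m + 1 else 1) * 2 ^ s) :=
        Finset.prod_le_prod (fun l _ => Nat.zero_le _) hfac
    _ = (∏ l ∈ Finset.univ.erase l₀, (if l ∈ F then m + 1 else 1)) * (2 ^ s) ^ (K - 1) := by
        rw [Finset.prod_mul_distrib, Finset.prod_const, Finset.card_erase_of_mem (Finset.mem_univ _),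
          Finset.card_univ, Fintype.card_fin]
    _ ≤ (m + 1) ^ F.card * (2 ^ s) ^ (K - 1) := by
        refine Nat.mul_le_mul_right _ ?_
        rw [Finset.prod_ite_mem, Finset.prod_const]
        exact Nat.pow_le_pow_right (Nat.succ_pos m) (Finset.card_le_card Finset.inter_subset_right)

/-- Positive zeros with few fat letters: `Z₊ + 1 ≤ (m+1)^{|F|} · (2^s)^{K−1}` whenever every letter outside
`F` has rank `< 2^s` (`K ≥ 1`). [folklore] -/
theorem card_posRoots_succ_le {K m : ℕ} (l₀ : Fin K) (d : Fin K → ℕ)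
    (S : Fin K → Matrix (Fin m) (Fin m) ℝ) (F : Finset (Fin K)) (s : ℕ)
    (hthin : ∀ l, l ∉ F → (S l).rank < 2 ^ s) :
    ((Matrix.det (∑ l, ((Polynomial.X : Polynomial ℝ) ^ d l) • (S l).map Polynomial.C)).roots.toFinset.filter
        (fun t => 0 < t)).card + 1 ≤ (m + 1) ^ F.card * (2 ^ s) ^ (K - 1) :=
  (lowRankCeiling l₀ d S).trans (prod_rank_succ_le l₀ S F s hthin)

/-- Exponent arithmetic of the window: `m + 1 ≤ 2^((⌊log₂K⌋+c)^c + 1)` in the regime. [folklore] -/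
theorem succ_size_le (c K m : ℕ) (hm : m ≤ 2 ^ ((Nat.log 2 K + c) ^ c)) :
    m + 1 ≤ 2 ^ ((Nat.log 2 K + c) ^ c + 1) := by
  have h1 : 1 ≤ 2 ^ ((Nat.log 2 K + c) ^ c) := Nat.one_le_two_pow
  rw [pow_succ]
  omega

end FewFatLetters

/-- **FEW FAT LETTERS.**  For all `c, q, s` there is `K₀` such that for all `K ≥ K₀`, all sizes
`m ≤ 2^((⌊log₂K⌋+c)^c)`, all exponents `d` and all real `m × m` matrices `Sₗ` (symmetric or not): if the
letters of rank `≥ 2^s` all lie in a set `F` with `4·q·|F|·((⌊log₂K⌋+c)^c + 1) ≤ K⌊log₂K⌋`, then the number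
`Z` of distinct real zeros of `det (∑ₗ X^{dₗ} Sₗ)` satisfies `Z^q ≤ 2^(K⌊log₂K⌋)`.  Equivalently: pencils
violating the `q`-th inequality of `MatrixDescartes` in its own size window must have more than
`K⌊log₂K⌋/(4q((⌊log₂K⌋+c)^c+1))` coefficients of rank `≥ 2^s` (any `s` with `2^(4qs) ≤ K`), for all large
`K`.  A necessary condition on monsters; nothing else is claimed. [folklore] -/
theorem fewFatLetters_mdr (c q s : ℕ) : ∃ K₀ : ℕ, ∀ K m : ℕ, K₀ ≤ K →
    m ≤ 2 ^ ((Nat.log 2 K + c) ^ c) →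
    ∀ (d : Fin K → ℕ) (S : Fin K → Matrix (Fin m) (Fin m) ℝ) (F : Finset (Fin K)),
      (∀ l, l ∉ F → (S l).rank < 2 ^ s) →
      4 * q * F.card * ((Nat.log 2 K + c) ^ c + 1) ≤ K * Nat.log 2 K →
      (Matrix.det (∑ l, ((Polynomial.X : Polynomial ℝ) ^ d l) • (S l).map Polynomial.C)
        ).roots.toFinset.card ^ q ≤ 2 ^ (K * Nat.log 2 K) := by
  refine ⟨max (2 ^ (4 * q * s)) (max 2 (4 * q)), fun K m hK hm d S F hthin hF => ?_⟩
  have hKs : 2 ^ (4 * q * s) ≤ K := le_trans (le_max_left _ _) hK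
  have hK2 : 2 ≤ K := le_trans (le_trans (le_max_left _ _) (le_max_right _ _)) hK
  have hK4q : 4 * q ≤ K := le_trans (le_trans (le_max_right _ _) (le_max_right _ _)) hK
  have hlogs : 4 * q * s ≤ Nat.log 2 K := Nat.le_log_of_pow_le (by norm_num) hKs
  have hlog1 : 1 ≤ Nat.log 2 K := by
    calc 1 = Nat.log 2 2 := by decide
      _ ≤ Nat.log 2 K := Nat.log_mono_right hK2
  obtain ⟨K', rfl⟩ : ∃ K', K = K' + 1 := ⟨K - 1, by omega⟩
  set L := (Nat.log 2 (K' + 1) + c) ^ c + 1 with hL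
  -- the reflected pencil has the same thin letters
  have hthin' : ∀ l, l ∉ F → (((-1 : ℝ) ^ d l) • S l).rank < 2 ^ s := fun l hl =>
    lt_of_le_of_lt (Literature.Computability.AlgebraicComplexity.rank_smul_le _ _) (hthin l hl)
  have hA := FewFatLetters.card_posRoots_succ_le (⟨0, by omega⟩ : Fin (K' + 1)) d S F s hthin
  have hB := FewFatLetters.card_posRoots_succ_le (⟨0, by omega⟩ : Fin (K' + 1)) d
    (fun l => ((-1 : ℝ) ^ d l) • S l) F s hthin'
  rw [Nat.add_sub_cancel] at hA hB
  have hZ := stub_negRoots (K' + 1) m d S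
  -- the common bound `P = (m+1)^|F| (2^s)^K' ≤ 2^(L|F| + sK')`
  have hm1 : m + 1 ≤ 2 ^ L := FewFatLetters.succ_size_le c (K' + 1) m hm
  have hP : (m + 1) ^ F.card * (2 ^ s) ^ K' ≤ 2 ^ (L * F.card + s * K') := by
    rw [pow_add, pow_mul, pow_mul]
    exact Nat.mul_le_mul_right _ (Nat.pow_le_pow_left hm1 _)
  have hZle : (Matrix.det (∑ l, ((Polynomial.X : Polynomial ℝ) ^ d l) •
      (S l).map Polynomial.C)).roots.toFinset.card ≤ 2 ^ (L * F.card + s * K' + 1) := by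
    rw [pow_succ]
    omega
  -- exponent arithmetic: `q (L|F| + sK' + 1) ≤ (K'+1) ⌊log₂ (K'+1)⌋`
  have h1 : 4 * q * 1 ≤ (K' + 1) * Nat.log 2 (K' + 1) := by
    calc 4 * q * 1 = 4 * q := mul_one _
      _ ≤ K' + 1 := hK4q
      _ = (K' + 1) * 1 := (mul_one _).symm
      _ ≤ (K' + 1) * Nat.log 2 (K' + 1) := Nat.mul_le_mul_left _ hlog1
  have h2 : 4 * q * (s * K') ≤ (K' + 1) * Nat.log 2 (K' + 1) := by
    calc 4 * q * (s * K') = (4 * q * s) * K' := by ring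
      _ ≤ Nat.log 2 (K' + 1) * (K' + 1) := Nat.mul_le_mul hlogs (Nat.le_succ K')
      _ = (K' + 1) * Nat.log 2 (K' + 1) := mul_comm _ _
  have h3 : 4 * q * (L * F.card) ≤ (K' + 1) * Nat.log 2 (K' + 1) := by
    calc 4 * q * (L * F.card) = 4 * q * F.card * L := by ring
      _ ≤ (K' + 1) * Nat.log 2 (K' + 1) := hF
  have hexp : q * (L * F.card + s * K' + 1) ≤ (K' + 1) * Nat.log 2 (K' + 1) := by
    have hsum : 4 * (q * (L * F.card + s * K' + 1)) ≤ 3 * ((K' + 1) * Nat.log 2 (K' + 1)) := by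
      have e : 4 * (q * (L * F.card + s * K' + 1))
          = 4 * q * (L * F.card) + 4 * q * (s * K') + 4 * q * 1 := by ring
      rw [e]
      omega
    omega
  calc (Matrix.det (∑ l, ((Polynomial.X : Polynomial ℝ) ^ d l) •
          (S l).map Polynomial.C)).roots.toFinset.card ^ q
      ≤ (2 ^ (L * F.card + s * K' + 1)) ^ q := Nat.pow_le_pow_left hZle q
    _ = 2 ^ (q * (L * F.card + s * K' + 1)) := by rw [← pow_mul, mul_comm]
    _ ≤ 2 ^ ((K' + 1) * Nat.log 2 (K' + 1)) := Nat.pow_le_pow_right (by norm_num) hexp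

end Summit.ValiantsHypothesis.ValiantsHypothesis.Theorems.LacunarySymmetroidMatrixDescartes
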